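import Summits.BirchSwinnertonDyer.BirchSwinnertonDyer.Theorems.CMKolyvaginAtInertTwoCMPrimitiveSupplyAtInertTwoOfKolyvaginConjecture
import HarnessLib

/-!
# Route `CMKolyvaginAtInertTwo`: THE X-P SUPPLY RESTATED IN STEP WITH R1′ (`CMPrimitiveSupplyAtInertTwoOneBitOfFacts`), BY NAME

Seat `bsd-line-cmk2-p1` g22 (cell `bsd-print-cf2`).  Closes item stmt-BirchSwinnertonDyer-28664 `CMPrimitiveSupplyAtInertTwoOneBitOfFacts`
(route rev 19/20, pen bsd-idea-1 g23): (BCDT modularity ∧ Gross–Zagier at every level) → HL′ (`CMSilentHeegnerTwinSupplyAtInertTwo`, crux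
28663: a Heegner field with ONE-BIT genus defect and `L(E^{(d_K)},1) ≠ 0`) → Kolyvagin's conjecture at inert `2`
(`CMKolyvaginConjectureAtInertTwo`, crux 24648) → for every `E ∈ H₂` with an optimal odd-Manin frame: the output of the Σ-free supply 24276
∧ «`Σ ≤ 1`».  Proof = g3's `CMSupply.cmPrimitiveSupplyAtInertTwo_of_kolyvaginConjectureAtTwo` (p594599) with the Hoffstein–Luo step replaced
by the HL′ field: the two Kolyvagin non-squares are automatic on H₂ (`KolyvaginFrobeniusTwo.not_isSquare_and_of_cmInert_two_of_heegner`),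
the frame `(β, ι, d₁)` comes from the Heegner condition and Darmon's Thm. 3.6 (`exists_dvd_sq_sub_discr_holds`,
`exists_kolyvaginHeegnerData_one`), `y_K` has infinite order by Gross–Zagier (`CMSupply.not_isOfFinAddOrder_derivedPoint_one_of_rankOne`),
`M₀` exists by Mordell–Weil over `K[1]`, the certificate is 24648's, the twin is `CMSupply.exists_minimal_twin_hasCM_analyticRank_zero`.

HONEST FRAMING: a DERIVATION item — its research antecedents HL′ (28663) and 24648 are displayed hypotheses, not proved; the two prints are
statement-only.  BSD is NOT proved by this; the leaf `WAllCornerFTwo` is NOT closed by this.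

References: [GrossLMS1991] §3, §11 (Question); [GrossZagier1986] Thm. I.6.3, V.§2; [Darmon2004] Thm. 3.6; [WZhang2014] Thm. 1.1;
[McCallumLMS1991] §5 Lemma 5.1; [SilvermanAEC2009] VIII.8.3, X.5.4.
-/

-- single-conjunct summit: `Summit.BirchSwinnertonDyer.BirchSwinnertonDyer.…` repeats the name by design
set_option linter.dupNamespace false
set_option autoImplicit false

noncomputable section

open scoped Classical

namespace Summit.BirchSwinnertonDyer.BirchSwinnertonDyer.Theorems

open WeierstrassCurve NumberField
open Literature.NumberTheory.EllipticCurves Literature.NumberTheory.EllipticCurves.ModularForms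
open Literature.NumberTheory.EllipticCurves.Rank1Residual

/-- **Item 28664 `CMPrimitiveSupplyAtInertTwoOneBitOfFacts`, BY NAME**: (modularity ∧ Gross–Zagier at every level) → the silent Heegner
twin supply HL′ → Kolyvagin's conjecture at inert `2` → the one-bit X-P supply on H₂ (Heegner field with odd `d_K ≠ −3` and `Σ ≤ 1`, the two
non-squares, an odd-Manin frame with `y_K` of infinite order and exact exponent `M₀`, a `2`-primitive derived class on CM-inert Kolyvagin
primes, a globally minimal CM twin of analytic rank `0`).  BSD is NOT proved by this. [cite: GrossLMS1991, §11 (Question) and §3]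
[cite: GrossZagier1986, Thm. I.6.3] [cite: Darmon2004, Thm. 3.6] [cite: WZhang2014, Thm. 1.1] -/
theorem cmPrimitiveSupplyAtInertTwoOneBitOfFacts_proof :
    Summit.BirchSwinnertonDyer.BirchSwinnertonDyer.Theses.CMKolyvaginAtInertTwo.CMPrimitiveSupplyAtInertTwoOneBitOfFacts := by
  rintro ⟨hmod, hGZ⟩ hHS hKoly W _ _ _ hCM hin hρ hr hT ⟨Dt, hDt, hc⟩
  -- HL′: the one-bit Heegner field with `L(E^{(d_K)}, 1) ≠ 0`
  obtain ⟨K, _, _, hK, hodd, h3, hH, hdef, hL⟩ := hHS W hCM hin hρ hr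
  -- the two non-square exclusions are automatic on H₂
  obtain ⟨hsq1, hsq2⟩ :=
    KolyvaginFrobeniusTwo.not_isSquare_and_of_cmInert_two_of_heegner W hCM hin hρ K hK hodd hH
  -- the frame `(Dt, β, ι, d₁)`
  obtain ⟨β, hβ⟩ := exists_dvd_sq_sub_discr_holds (W.conductorNorm ℤ) K hK hH
  let ι : K →+* ℂ := Classical.choice inferInstance
  obtain ⟨d₁⟩ := exists_kolyvaginHeegnerData_one
    (phi_heegnerTau_mem_singularModuliField_holds (W.conductorNorm ℤ) W K) hK Dt β ι hβ
  -- `y_K` of infinite order (Gross–Zagier + modularity)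
  have hy₁ : ¬ IsOfFinAddOrder d₁.derivedPoint :=
    CMSupply.not_isOfFinAddOrder_derivedPoint_one_of_rankOne hmod W K (hGZ _ W K) hK hH hr hL d₁
  -- the exact exponent `M₀` (Mordell–Weil over the number field `K[1]`)
  haveI : NumberField (ringClassField K ι 1) := numberField_ringClassField hK ι one_ne_zero
  haveI : (W.baseChange (ringClassField K ι 1)).IsElliptic := by rw [baseChange]; infer_instance
  haveI : Module.Finite ℤ (W.baseChange (ringClassField K ι 1)).toAffine.Point := by
    convert (W.baseChange (ringClassField K ι 1)).module_finite_point_holds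
  obtain ⟨M₀, hdiv, hndiv⟩ := exists_pow_smul_eq_and_not_of_not_isOfFinAddOrder Nat.prime_two hy₁
  -- Kolyvagin's conjecture at `2` (crux 24648)
  obtain ⟨n, d, hn, hKol, hprim⟩ := hKoly W hCM hin hρ hr hT K hK hodd h3 hH Dt hDt hc β ι d₁ hy₁
  -- the twin
  obtain ⟨Wd, _, _, hWd, hcmd, hrd⟩ := CMSupply.exists_minimal_twin_hasCM_analyticRank_zero hmod W hCM K hL
  exact ⟨K, _, _, hK, hodd, h3, hH, hdef, hsq1, hsq2, Dt, β, ι, d₁, hDt, hc, hy₁, M₀, hdiv, hndiv,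
    n, d, hn, hKol, hprim, Wd, ‹_›, ‹_›, hWd, hcmd, hrd⟩

end Summit.BirchSwinnertonDyer.BirchSwinnertonDyer.Theorems

end
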